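import Literature.Computability.AlgebraicComplexity.SymmetricArithCircuit
import Mathlib.Data.Fintype.Card
import Mathlib.Data.Fintype.Sum
import Mathlib.Logic.Equiv.Defs
import HarnessLib

/-!
# Symmetric circuits: the scaled-inputs layer `x ↦ t · x`

Topic `Computability/AlgebraicComplexity`, namespace `Literature.Computability.AlgebraicComplexity`.

A (tiny) closure property of Dawar–Wilsenach symmetric arithmetic circuits
(`SymmetricArithCircuit.lean`: `LabelledArithCircuit` = Def. 2.2, `IsAutomorphismExtending` =
Def. 3.6, `IsSymmetric` = Def. 3.7 and its bundled form `SymmetricArithmeticCircuit`, after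
A. Dawar, G. Wilsenach, *Symmetric Arithmetic Circuits*, Theory of Computing 21 (2025)): for a
group `Γ` acting on a finite set of variables `X` and a constant `t ∈ K`, the family
`(t · x)_{x ∈ X}` — outputs indexed by the `Γ`-set `X` itself — is computed by ONE `Γ`-symmetric
labelled circuit on exactly `2 |X| + 1` gates (`LabelledArithCircuit.exists_scaledInputs`).
Composed with substitution this is the SCALING `f ↦ f(t · x)` of a symmetrically computed
polynomial `f`, the first step of the extraction of homogeneous components by interpolation.

Construction (`LabelledArithCircuit.ScaledInputs.circuit`): gates `inp x` (label `x`, no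
children), one constant gate `cst` (label `t`, no children) and product gates `out x` (label `×`,
children `{cst, inp x}` — two distinct gates, so `out x` evaluates to `C t * X x`, `eval_out`);
the output indexed `x` is `out x`. The group acts on the gates by `inp x ↦ inp (γ • x)`,
`out x ↦ out (γ • x)`, `cst ↦ cst`, which makes the circuit a `SymmetricArithmeticCircuit`
(`symmetricCircuit`, Def. 3.7 in bundled form), hence `IsSymmetric` (`isSymmetric`). Acyclicity
is by a rank function (inputs `0`, products `1`). Everything is folklore and proved; nothing here
is a named fact.
-/

noncomputable section

namespace Literature.Computability.AlgebraicComplexity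

open MvPolynomial

universe u v

namespace LabelledArithCircuit

namespace ScaledInputs

/-- Gates of the scaled-inputs circuit over the variables `X`: the inputs `inp x`, the constant
gate `cst` (labelled `t`) and the product gates `out x = t × x` (the outputs). [folklore] -/
inductive Gate (X : Type v) : Type v
  /-- Input gate labelled by the variable `x`. -/
  | inp (x : X) : Gate X
  /-- The constant gate, labelled `t`. -/
  | cst : Gate X
  /-- The product gate `t × x`, the output indexed `x`. -/
  | out (x : X) : Gate X
  deriving DecidableEq

namespace Gate

variable {X : Type v}

/-- The gates as a sum type: `Gate X ≃ X ⊕ X ⊕ Unit`. [folklore] -/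
def equivSum : Gate X ≃ X ⊕ X ⊕ Unit where
  toFun
    | inp x => Sum.inl x
    | cst => Sum.inr (Sum.inr ())
    | out x => Sum.inr (Sum.inl x)
  invFun
    | Sum.inl x => inp x
    | Sum.inr (Sum.inl x) => out x
    | Sum.inr (Sum.inr _) => cst
  left_inv g := by cases g <;> rfl
  right_inv s := by rcases s with x | x | ⟨⟩ <;> rfl

/-- The gate type of a finite set of variables is finite. [folklore] -/
instance instFintype [Fintype X] : Fintype (Gate X) := Fintype.ofEquiv _ equivSum.symm

/-- **Size.** The scaled-inputs circuit has exactly `2 |X| + 1` gates.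
[cite: DawarWilsenach2025, Def. 2.2 (size)] -/
theorem card_eq [Fintype X] : Fintype.card (Gate X) = 2 * Fintype.card X + 1 := by
  rw [Fintype.card_congr equivSum]
  simp only [Fintype.card_sum, Fintype.card_unit]
  omega

section Action

variable {Γ : Type*} [Group Γ] [MulAction Γ X]

/-- `Γ` acts on the gates through its action on the variables (`inp x ↦ inp (γ • x)`,
`out x ↦ out (γ • x)`); the constant gate is fixed. [cite: DawarWilsenach2025, Def. 3.6] -/
instance instMulAction : MulAction Γ (Gate X) where
  smul γ
    | inp x => inp (γ • x)
    | cst => cst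
    | out x => out (γ • x)
  one_smul g := by
    cases g with
    | inp x => exact congrArg inp (one_smul Γ x)
    | cst => rfl
    | out x => exact congrArg out (one_smul Γ x)
  mul_smul γ γ' g := by
    cases g with
    | inp x => exact congrArg inp (mul_smul γ γ' x)
    | cst => rfl
    | out x => exact congrArg out (mul_smul γ γ' x)

/-- The action on input gates. [cite: DawarWilsenach2025, Def. 3.6] -/
@[simp] theorem smul_inp (γ : Γ) (x : X) : γ • (inp x : Gate X) = inp (γ • x) := rfl

/-- The constant gate is fixed. [cite: DawarWilsenach2025, Def. 3.6] -/
@[simp] theorem smul_cst (γ : Γ) : γ • (cst : Gate X) = cst := rfl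

/-- The action on product (output) gates. [cite: DawarWilsenach2025, Def. 3.6] -/
@[simp] theorem smul_out (γ : Γ) (x : X) : γ • (out x : Gate X) = out (γ • x) := rfl

end Action

/-- Rank of a gate (inputs and the constant `0`, products `1`), used for acyclicity. [folklore] -/
def rank : Gate X → ℕ
  | inp _ => 0
  | cst => 0
  | out _ => 1

variable [DecidableEq X]

/-- Children in the scaled-inputs circuit: only the product gate `out x` has children, namely
`cst` and `inp x`. [folklore] -/
def children : Gate X → Finset (Gate X)
  | inp _ => ∅
  | cst => ∅
  | out x => {cst, inp x}

/-- Labels in the scaled-inputs circuit: `inp x ↦ x`, `cst ↦ t`, `out x ↦ ×`. [folklore] -/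
def label {K : Type u} (t : K) : Gate X → CircuitLabel K X
  | inp x => .var x
  | cst => .const t
  | out _ => .mul

/-- Children have smaller rank. [folklore] -/
theorem rank_lt_of_mem_children {g h : Gate X} (hh : h ∈ children g) : rank h < rank g := by
  cases g with
  | inp x => simp [children] at hh
  | cst => simp [children] at hh
  | out x =>
    simp only [children, Finset.mem_insert, Finset.mem_singleton] at hh
    rcases hh with rfl | rfl <;> simp [rank]

end Gate

variable {K : Type u} {X : Type v} [DecidableEq X]

open Gate in
/-- **The scaled-inputs circuit** for the constant `t`: inputs `x`, one constant gate `t`, and the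
product gates `t × x` as the outputs indexed by `x ∈ X` (a labelled DAG in the sense of
Dawar–Wilsenach Def. 2.2: in-degree `0` exactly at the variable and constant gates, whose labels
are pairwise distinct). [cite: DawarWilsenach2025, Def. 2.2] -/
def circuit (t : K) : LabelledArithCircuit K X X (Gate X) where
  children := Gate.children
  label := Gate.label t
  output := .out
  wf := Subrelation.wf (fun {_ _} hh => rank_lt_of_mem_children hh)
    (InvImage.wf Gate.rank Nat.lt_wfRel.wf)
  isInput_iff g := by cases g <;> simp [Gate.label, Gate.children]
  eq_of_label_eq g g' hg hl := by
    cases g with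
    | inp x =>
      cases g' with
      | inp x' => simpa [Gate.label] using hl
      | cst => simp [Gate.label] at hl
      | out x' => simp [Gate.label] at hl
    | cst =>
      cases g' with
      | inp x' => simp [Gate.label] at hl
      | cst => rfl
      | out x' => simp [Gate.label] at hl
    | out x => simp [Gate.label] at hg
  output_injective _ _ h := Gate.out.inj h

/-- **The scaled-inputs circuit with `Γ` acting on its gates** is a `SymmetricArithmeticCircuit`
(Dawar–Wilsenach Def. 3.7 in bundled form): wires go to wires (`{cst, inp x} ↦ {cst, inp (γ • x)}`),
labels transform under `γ`, and the output indexed `x` goes to the output indexed `γ • x`.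
[cite: DawarWilsenach2025, Def. 3.7] -/
def symmetricCircuit (Γ : Type*) [Group Γ] [MulAction Γ X] (t : K) :
    SymmetricArithmeticCircuit Γ K X X (Gate X) where
  toLabelledArithCircuit := circuit t
  children_smul γ g := by
    cases g with
    | inp x => simp [circuit, Gate.children]
    | cst => simp [circuit, Gate.children]
    | out x => simp [circuit, Gate.children, Finset.map_insert, Finset.map_singleton]
  label_smul γ g := by cases g <;> rfl
  output_smul _ _ := rfl

/-- **The scaled-inputs circuit is `Γ`-symmetric** (Def. 3.7): every `γ` extends to the circuit
automorphism `g ↦ γ • g`. [cite: DawarWilsenach2025, Def. 3.7] -/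
theorem isSymmetric (Γ : Type*) [Group Γ] [MulAction Γ X] (t : K) :
    (circuit (X := X) t).IsSymmetric Γ :=
  (symmetricCircuit Γ t).isSymmetric

section Eval

variable [CommSemiring K] (t : K)

/-- An input gate evaluates to its variable. [cite: DawarWilsenach2025, §3.3] -/
theorem eval_inp (x : X) : (circuit t).eval (.inp x) = MvPolynomial.X x :=
  (circuit t).eval_of_label_var rfl

/-- The constant gate evaluates to the constant `t`. [cite: DawarWilsenach2025, §3.3] -/
theorem eval_cst : (circuit t).eval (.cst : Gate X) = MvPolynomial.C t :=
  (circuit t).eval_of_label_const rfl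

/-- **The product gate `out x` computes `t · x`** (product of its two distinct children `cst` and
`inp x`). [cite: DawarWilsenach2025, §2 (evaluation)] -/
theorem eval_out (x : X) : (circuit t).eval (.out x) = MvPolynomial.C t * MvPolynomial.X x := by
  rw [(circuit t).eval_of_label_mul (g := .out x) rfl,
    show (circuit t).children (.out x) = ({Gate.cst, Gate.inp x} : Finset (Gate X)) from rfl,
    Finset.prod_pair (by simp), eval_cst, eval_inp]

/-- **The outputs compute the family `(t · x)_{x ∈ X}`.**
[cite: DawarWilsenach2025, §2 ("the polynomial computed by C is the value of the output gate")] -/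
theorem eval_output (x : X) :
    (circuit t).eval ((circuit t).output x) = MvPolynomial.C t * MvPolynomial.X x :=
  eval_out t x

end Eval

end ScaledInputs

/-- **Scaled inputs, symmetrically.** For any group `Γ` acting on a finite set of variables `X`
and any constant `t`: the family `(t · x)_{x ∈ X}`, at outputs indexed by the `Γ`-set `X`, is
computed by a `Γ`-symmetric labelled circuit on at most `2 |X| + 1` gates (Dawar–Wilsenach
Defs. 2.2, 3.6, 3.7; the construction is `ScaledInputs.circuit`: inputs `x`, one constant gate `t`,
products `t × x`). [cite: DawarWilsenach2025, Def. 3.7] -/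
theorem exists_scaledInputs {K : Type u} [CommSemiring K] {X : Type v} [Fintype X] [DecidableEq X]
    (Γ : Type*) [Group Γ] [MulAction Γ X] (t : K) :
    ∃ (G : Type v) (_ : Fintype G) (C : LabelledArithCircuit K X X G),
      C.IsSymmetric Γ ∧
      (∀ x, C.eval (C.output x) = MvPolynomial.C t * MvPolynomial.X x) ∧
      Fintype.card G ≤ 2 * Fintype.card X + 1 :=
  ⟨ScaledInputs.Gate X, inferInstance, ScaledInputs.circuit t, ScaledInputs.isSymmetric Γ t,
    ScaledInputs.eval_output t, ScaledInputs.Gate.card_eq.le⟩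

end LabelledArithCircuit

end Literature.Computability.AlgebraicComplexity

end
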